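import Literature.MathematicalPhysics.QuantumFieldTheory.Balaban1983to89.B4Ineq110WalkRoute
import Literature.MathematicalPhysics.QuantumFieldTheory.Balaban1983to89.B4Lemma22Reduce231

/-!
# `Balaban1983to89.B4CubeOpReindex` — [Balaban1983RegularityDecay] §2 pp. 575–576: the cube propagators
# `G_k(□_j, Ã_j)` of the parametrix (2.2) ARE the Green's functions (1.6) OF THE SUB-REGION `□_j` (Neumann boundary
# conditions on `∂□_j`, (2.6)) — the CARRIER BRIDGE between the Neumann-cut cube operators of the walk route
# (`B4Eq26Locality`, `B4Ineq110WalkRoute`: cube operator = the `Ω`-operator with bond weights cut at `∂□_j`, acting on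
# the whole site set) and the operators (1.6) on the cube's OWN site set (the box carriers of the Lemma-2.2 lineage,
# `B4Lemma22ReduceZero.opA/greenA`), with the norm dictionary `‖·‖_{ℓ∞→ℓ∞} ≤ √N·(sup-norm bound)`

statement-level skeleton of published theorems with citation tags; proofs where landed; nothing here is a claim about the Yang–Mills mass gap

CITATION HEADER.  T. Bałaban, *Regularity and decay of lattice Green's functions*, Commun. Math. Phys. **89** (1983)
571–597, doi:10.1007/bf01214744 [Balaban1983RegularityDecay] (cell paper B4; held text
`paper:balaban1983-cmp89-regularity-decay`, journal page = PDF page + 570; pp. 572, 575–578).  Unit `lit-balaban-p17`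
gen 4 (Phase-2 proof seat p17; HOME `run/shared/lean/pub/lit-balaban/`), SKELETON rows **B4.Eq2.2** (`G₀ =
Σ_j h_jG_k(□_j,Ã_j)h_j`), **B4.Eq2.10** (`R = Σ_j K_jG_k(□_j,Ã_j)h_j`), **B4.Thm@573** (the per-cube inputs `γ`, `β` of
the walk route, reserve item R9 «carrier bridge»).  Theorems + plumbing `def`s with bodies (`pad`, `covKer`, `cdeg`,
`cdiag`, `cinv`, reducible `cutWt`); imports `B4Ineq110WalkRoute` (→ `B4Commutators25to211`: `mulH`, `opK`, `covOp`,
block kernels, `mulH_apply`) and `B4Lemma22Reduce231` (`siteNorm`, `supN`).  Norm: Mathlib's scope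
`Matrix.Norms.Operator` (`‖A‖ = max_i Σ_j |A_ij|`, the `ℓ^∞ → ℓ^∞` operator norm of the factors of (2.20)).

WHAT IS PRINTED (verbatim).  p. 575: *«Let us define an operator G₀ by the formula G₀ = Σ_j h_jG_k(□_j, A_j)h_j, (2.2)»*
— `G_k(□_j, A_j)` being the Green's function (1.6) *«on a domain Ω with Neumann boundary conditions on ∂Ω»* (p. 572;
(1.3): *«the summation is over the set of all bonds b = ⟨b₋,b₊⟩ with end-points b₋, b₊ in Ω»*) for the domain `□_j`;
p. 576: *«Special care has to be taken in considering boundary terms. Let us remark now that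
(−Δ^{η,N}_{A,Ω})h_jG(□_j, A_j) = (−Δ^{η,N}_{A_j,□_j})h_jG(□_j, A_j), (2.6) because the function h_j can be ≠ 0 only on
the part of the boundary of □_j which is contained in the boundary of Ω.»*; p. 578: *«Here ‖T‖_{q,p} denotes a norm of
an operator T : L^p → L^q»* (the factors of (2.20) are `‖·‖_{∞,∞}` norms).

WHY THIS FILE.  The walk-route theorems (`B4Ineq110WalkRoute.ineq110_value` and its siblings) model the cube operator
`−Δ^{η,N}_{Ã_j,□_j} + m² + aP_k(Ã_j)` as the operator (1.6) on the WHOLE site set `X` of `Ω` with the bond weights CUT at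
`∂□_j` (`c ↦ 1[z ∈ □_j ↔ z′ ∈ □_j]·c(z,z′)`) and cube links/transporters `W′, T′`, and ask for a two-sided inverse `G_j`
on `X` with `‖G_j‖ ≤ γ` and `‖K_jG_jh_j‖ ≤ β`.  The Lemma-2.2 lineage proves such bounds for the operator (1.6) on the
cube's OWN site set (a box).  This file proves, for ANY finite site sets, that the two agree: the cut operator is reduced
by `1_{□_j}`; its `□_j`-block, re-indexed along the inclusion `e : □_j ↪ X`, IS the operator (1.6) of the sub-region
with the restricted data; with NULL links/transporters outside `□_j` (a legitimate choice of the free data `W′, T′` off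
the plateau, on which `B4Eq26Locality.eq26_hCube` puts no condition) the complementary block is the diagonal
`(deg + m²) ⊗ 1_N`; hence an explicit two-sided inverse `G_j = pad_e(G_k(□_j,Ã_j)) + (diagonal)⁻¹`, whose norm and
whose letters `h_jG_jh_j`, `K_jG_jh_j` are those of the sub-region operator.

WHAT THIS MODULE PROVES (all in full; `X ⊇ e(X′)` finite site sets, `Y ⊇ e_Y(Y′)` block labels, colours `κ`).
* §1 `sum_range` — a sum over `X` of a function vanishing off `e(X′)` is the sum over `X′`.
* §2 `pad e B` — zero-padding of an operator on `X′ × κ` to `X × κ`: entries (`pad_apply_img`, `pad_apply_of_left/right`),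
  `pad_submatrix` (re-indexing recovers `B`), `pad_mul`, `pad_add`, `pad_sub`, `pad_one` (`= 1_{e(X′)}`), `mulH_eq_pad`
  (a multiplication operator supported in `e(X′)` is padded), and **`norm_pad`**: `‖pad e B‖ = ‖B‖`.
* §3 THE CUT OPERATOR: `covOp_eq_blockOp'` (block kernel `covKer` of (1.6)), **`covOp_cut_submatrix`** — the
  `e(X′)`-block of `covOp (cutWt S c) m2 a q W T`, re-indexed along `e`, is `covOp (c∘e) m2 a (q∘(e_Y,e)) (W∘e)
  (T∘(e_Y,e))` — print (2.6); `covOp_cut_apply_off` (no entry joins `□_j` to its complement: bonds cut, blocks do not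
  straddle); `covOp_cut_apply_compl` (null data off `□_j` ⇒ complement block `= (cdeg + m²)·1`);
  **`covOp_cut_eq_pad_add`**: `H_cut = pad_e(H_□) + cdiag`.
* §4 THE INVERSE: `cinv` (the diagonal inverse off `□_j`), **`covOp_cut_mul_padInv`**: `H_cut·(pad_e(G_□) + cinv) = 1`
  whenever `H_□·G_□ = 1` and `cdeg + m² ≠ 0` off `□_j` — the hypothesis `hGj` of the walk route; **`norm_padInv_le`**:
  `‖pad_e(G_□) + cinv‖ ≤ max ‖G_□‖ m₀⁻¹` (`0 < m₀ ≤ cdeg + m²` off `□_j`) — the input `γ`.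
* §5 THE LETTERS: for `supp h ⊆ □_j`, `h·G_j·h = pad_e(h_□·G_□·h_□)` (`letter_a_eq_pad`) and
  `K_h·G_j·h = pad_e(K_{h_□}·G_□·h_□)` (`opK_cut_eq_pad`, `letter_b_eq_pad`), with equal norms (`norm_letter_a`,
  `norm_letter_b`) — the input `β` is the sub-region's factor bound (2.20).
* §6 NORM DICTIONARY `linfty_opNorm_le_of_supN`: an operator with `supN(TΦ) ≤ C·supN(Φ)` for all `Φ` (the lineage's
  sup norm: sup over sites of the Euclidean colour norm) has `‖T‖_{ℓ∞→ℓ∞} ≤ √(card κ)·C`.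

HONEST SCOPE.  Pure finite-dimensional bookkeeping, no analysis: nothing here bounds `G_k(□_j,Ã_j)` itself (Lemmas
2.1/2.2 — the lineage's `B4Lemma22*`, `B4Eq220FactorField`, p35's `B4Eq220CubeField`); the choice of NULL
links/transporters off `□_j` concerns only the free data of the walk route's cube operators outside the plateau and
reproduces the print's `G_k(□_j,Ã_j)` on `□_j` exactly; the geometry (which `S`, `e`, `e_Y`; boxes) is left to the
instance (`B4SubBoxCarrier`).  `def`s with bodies only, no `Prop` fact, no `sorry`; axioms standard.
-/

namespace Literature.MathematicalPhysics.QuantumFieldTheory.Balaban1983to89.B4CubeOpReindex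

open Literature.MathematicalPhysics.QuantumFieldTheory.Balaban1983to89.B4GaugeCovariance
open Literature.MathematicalPhysics.QuantumFieldTheory.Balaban1983to89.B4Commutators25to211
open Literature.MathematicalPhysics.QuantumFieldTheory.Balaban1983to89.B4Ineq110WalkRoute (mulH_apply)
open Literature.MathematicalPhysics.QuantumFieldTheory.Balaban1983to89.B4Lemma21Region (siteNorm)
open Literature.MathematicalPhysics.QuantumFieldTheory.Balaban1983to89.B4Lemma22Reduce231 (supN le_supN supN_le)
open scoped Matrix NNReal
open scoped Matrix.Norms.Operator

noncomputable section

variable {X X' Y Y' κ : Type}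

/-! ## §1. Sums over the range of an injection -/

section Range

variable [Fintype X] [Fintype X']

/-- a sum over `X` of a function vanishing off the range of an injection `e : X′ → X` is the sum over `X′`. [folklore] -/
private theorem sum_range {M : Type*} [AddCommMonoid M] {e : X' → X} (he : Function.Injective e) (f : X → M)
    (hf : ∀ z, (∀ a, e a ≠ z) → f z = 0) : ∑ z, f z = ∑ a, f (e a) := by
  classical
  rw [← Finset.sum_image (f := f) (s := Finset.univ) (g := e) (fun a _ b _ h => he h)]
  symm
  apply Finset.sum_subset (Finset.subset_univ _)
  intro z _ hz
  apply hf
  intro a ha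
  exact hz (Finset.mem_image.mpr ⟨a, Finset.mem_univ a, ha⟩)

end Range

/-! ## §2. Zero-padding of an operator on `X′ × κ` along `e : X′ ↪ X` -/

section Pad

variable [Fintype X'] [DecidableEq X]

/-- **ZERO-PADDING** of an operator `B` on the sub-region's fields (`X′ × κ`) to the fields on `X × κ` along
`e : X′ → X`: the entry `((e a, k), (e a′, k′))` is `B((a,k),(a′,k′))`, every other entry is `0` (for injective `e`).
This is how `G_k(□_j, Ã_j)`, an operator on functions on `□_j`, acts in (2.2)/(2.13) on functions on `Ω`.
[cite: Balaban1983RegularityDecay, (2.2) p.575, dictionary] -/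
def pad (e : X' → X) (B : Matrix (X' × κ) (X' × κ) ℝ) : Matrix (X × κ) (X × κ) ℝ :=
  Matrix.of fun p p' => ∑ a, ∑ a', if e a = p.1 ∧ e a' = p'.1 then B (a, p.2) (a', p'.2) else 0

/-- the padded operator on the image: `pad e B (e a, k) (e a′, k′) = B (a,k) (a′,k′)`. [cite: Balaban1983RegularityDecay, (2.2) p.575 (dictionary: `G_k(□_j,Ã_j)` acting on functions on `Ω`)] -/
theorem pad_apply_img {e : X' → X} (he : Function.Injective e) (B : Matrix (X' × κ) (X' × κ) ℝ) (a a' : X')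
    (k k' : κ) : pad e B (e a, k) (e a', k') = B (a, k) (a', k') := by
  rw [pad, Matrix.of_apply, Finset.sum_eq_single a, Finset.sum_eq_single a']
  · simp
  · intro b _ hb
    rw [if_neg]
    rintro ⟨-, h⟩
    exact hb (he h)
  · intro h; exact absurd (Finset.mem_univ a') h
  · intro b _ hb
    refine Finset.sum_eq_zero fun b' _ => ?_
    rw [if_neg]
    rintro ⟨h, -⟩
    exact hb (he h)
  · intro h; exact absurd (Finset.mem_univ a) h

/-- the padded operator vanishes on rows off the image. [cite: Balaban1983RegularityDecay, (2.2) p.575 (dictionary: `G_k(□_j,Ã_j)` acting on functions on `Ω`)] -/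
theorem pad_apply_of_left (e : X' → X) (B : Matrix (X' × κ) (X' × κ) ℝ) {p : X × κ} (hp : ∀ a, e a ≠ p.1)
    (p' : X × κ) : pad e B p p' = 0 := by
  rw [pad, Matrix.of_apply]
  refine Finset.sum_eq_zero fun a _ => Finset.sum_eq_zero fun a' _ => ?_
  rw [if_neg]
  rintro ⟨h, -⟩
  exact hp a h

/-- the padded operator vanishes on columns off the image. [cite: Balaban1983RegularityDecay, (2.2) p.575 (dictionary: `G_k(□_j,Ã_j)` acting on functions on `Ω`)] -/
theorem pad_apply_of_right (e : X' → X) (B : Matrix (X' × κ) (X' × κ) ℝ) (p : X × κ) {p' : X × κ}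
    (hp' : ∀ a, e a ≠ p'.1) : pad e B p p' = 0 := by
  rw [pad, Matrix.of_apply]
  refine Finset.sum_eq_zero fun a _ => Finset.sum_eq_zero fun a' _ => ?_
  rw [if_neg]
  rintro ⟨-, h⟩
  exact hp' a' h

/-- RE-INDEXING RECOVERS THE OPERATOR: `(pad e B)|_{e(X′)} = B`. [cite: Balaban1983RegularityDecay, (2.2) p.575 (dictionary: `G_k(□_j,Ã_j)` acting on functions on `Ω`)] -/
theorem pad_submatrix {e : X' → X} (he : Function.Injective e) (B : Matrix (X' × κ) (X' × κ) ℝ) :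
    (pad e B).submatrix (Prod.map e id) (Prod.map e id) = B := by
  ext ⟨a, k⟩ ⟨a', k'⟩
  simp only [Matrix.submatrix_apply, Prod.map_apply, id_eq]
  exact pad_apply_img he B a a' k k'

/-- padding is additive. [cite: Balaban1983RegularityDecay, (2.2) p.575 (dictionary: `G_k(□_j,Ã_j)` acting on functions on `Ω`)] -/
theorem pad_add (e : X' → X) (B C : Matrix (X' × κ) (X' × κ) ℝ) : pad e (B + C) = pad e B + pad e C := by
  ext p p'
  simp only [pad, Matrix.of_apply, Matrix.add_apply, ← Finset.sum_add_distrib]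
  refine Finset.sum_congr rfl fun a _ => Finset.sum_congr rfl fun a' _ => ?_
  split_ifs <;> simp

/-- padding respects differences. [cite: Balaban1983RegularityDecay, (2.2) p.575 (dictionary: `G_k(□_j,Ã_j)` acting on functions on `Ω`)] -/
theorem pad_sub (e : X' → X) (B C : Matrix (X' × κ) (X' × κ) ℝ) : pad e (B - C) = pad e B - pad e C := by
  ext p p'
  simp only [pad, Matrix.of_apply, Matrix.sub_apply, ← Finset.sum_sub_distrib]
  refine Finset.sum_congr rfl fun a _ => Finset.sum_congr rfl fun a' _ => ?_
  split_ifs <;> simp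

section PadMul

variable [Fintype X] [Fintype κ]

/-- padding is multiplicative: `pad(B)·pad(C) = pad(B·C)` (products of padded cube letters in (2.13) are padded products). [cite: Balaban1983RegularityDecay, (2.2) p.575, (2.13) p.577 (dictionary)] -/
theorem pad_mul {e : X' → X} (he : Function.Injective e) (B C : Matrix (X' × κ) (X' × κ) ℝ) :
    pad e B * pad e C = pad e (B * C) := by
  ext p p'
  rw [Matrix.mul_apply]
  by_cases hp : ∃ a, e a = p.1
  · by_cases hp' : ∃ a', e a' = p'.1
    · obtain ⟨a, ha⟩ := hp
      obtain ⟨a', ha'⟩ := hp'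
      obtain ⟨z, k⟩ := p
      obtain ⟨z', k'⟩ := p'
      simp only at ha ha'
      subst ha; subst ha'
      rw [pad_apply_img he, Matrix.mul_apply, Fintype.sum_prod_type,
        sum_range (M := ℝ) he (fun x => ∑ k'', pad e B (e a, k) (x, k'') * pad e C (x, k'') (e a', k'))
          (fun x hx => Finset.sum_eq_zero fun k'' _ => by
            rw [pad_apply_of_right e B _ (p' := (x, k'')) (fun b => hx b), zero_mul]),
        Fintype.sum_prod_type]
      refine Finset.sum_congr rfl fun b _ => Finset.sum_congr rfl fun k'' _ => ?_
      rw [pad_apply_img he, pad_apply_img he]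
    · rw [pad_apply_of_right e (B * C) p (fun a h => hp' ⟨a, h⟩)]
      refine Finset.sum_eq_zero fun r _ => ?_
      rw [pad_apply_of_right e C r (fun a h => hp' ⟨a, h⟩), mul_zero]
  · rw [pad_apply_of_left e (B * C) (fun a h => hp ⟨a, h⟩)]
    refine Finset.sum_eq_zero fun r _ => ?_
    rw [pad_apply_of_left e B (fun a h => hp ⟨a, h⟩), zero_mul]

/-! ### The `ℓ^∞`-operator norm of a padded operator -/

omit [Fintype X'] [DecidableEq X] [Fintype X] [Fintype κ] in
/-- a row sum is at most the `ℓ^∞`-operator norm. [folklore] -/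
private theorem row_sum_le_norm {m n : Type*} [Fintype m] [Fintype n] (A : Matrix m n ℝ) (i : m) :
    ∑ j, |A i j| ≤ ‖A‖ := by
  rw [Matrix.linfty_opNorm_def]
  have h : (∑ j, ‖A i j‖₊ : ℝ≥0) ≤ Finset.univ.sup fun i => ∑ j, ‖A i j‖₊ :=
    Finset.le_sup (f := fun i => ∑ j, ‖A i j‖₊) (Finset.mem_univ i)
  have h' := NNReal.coe_le_coe.mpr h
  simp only [NNReal.coe_sum, coe_nnnorm, Real.norm_eq_abs] at h'
  exact h'

omit [Fintype X'] [DecidableEq X] [Fintype X] [Fintype κ] in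
/-- the `ℓ^∞`-operator norm is bounded by any common bound of the row sums. [folklore] -/
private theorem norm_le_of_rows {m n : Type*} [Fintype m] [Fintype n] (A : Matrix m n ℝ) {C : ℝ} (hC : 0 ≤ C)
    (h : ∀ i, ∑ j, |A i j| ≤ C) : ‖A‖ ≤ C := by
  rw [Matrix.linfty_opNorm_def]
  have : (Finset.univ.sup fun i => ∑ j, ‖A i j‖₊ : ℝ≥0) ≤ C.toNNReal := by
    refine Finset.sup_le fun i _ => ?_
    rw [← NNReal.coe_le_coe, Real.coe_toNNReal C hC]
    simp only [NNReal.coe_sum, coe_nnnorm, Real.norm_eq_abs]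
    exact h i
  have h2 := NNReal.coe_le_coe.mpr this
  rwa [Real.coe_toNNReal C hC] at h2

/-- the row sums of a padded operator on the image are those of `B` (the `ℓ^∞`-operator norm is a maximal row sum). [cite: Balaban1983RegularityDecay, (2.20) p.578 «‖·‖_∞» (dictionary)] -/
theorem row_sum_pad {e : X' → X} (he : Function.Injective e) (B : Matrix (X' × κ) (X' × κ) ℝ) (a : X') (k : κ) :
    ∑ p', |pad e B (e a, k) p'| = ∑ q, |B (a, k) q| := by
  rw [Fintype.sum_prod_type, Fintype.sum_prod_type,
    sum_range (M := ℝ) he (fun x => ∑ k', |pad e B (e a, k) (x, k')|)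
      (fun x hx => Finset.sum_eq_zero fun k' _ => by
        rw [pad_apply_of_right e B _ (p' := (x, k')) (fun b => hx b), abs_zero])]
  refine Finset.sum_congr rfl fun a' _ => Finset.sum_congr rfl fun k' _ => ?_
  rw [pad_apply_img he]

/-- **PADDING PRESERVES THE `ℓ^∞`-OPERATOR NORM**: `‖pad e B‖ = ‖B‖` — the `‖·‖_∞`-norms of the cube letters in (2.20) may be computed on the cube. [cite: Balaban1983RegularityDecay, (2.20) p.578 (dictionary)] -/
theorem norm_pad {e : X' → X} (he : Function.Injective e) (B : Matrix (X' × κ) (X' × κ) ℝ) : ‖pad e B‖ = ‖B‖ := by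
  apply le_antisymm
  · refine norm_le_of_rows _ (norm_nonneg B) fun p => ?_
    by_cases hp : ∃ a, e a = p.1
    · obtain ⟨a, ha⟩ := hp
      obtain ⟨z, k⟩ := p
      simp only at ha
      subst ha
      rw [row_sum_pad he]
      exact row_sum_le_norm B (a, k)
    · rw [Finset.sum_eq_zero fun p' _ => by rw [pad_apply_of_left e B (fun a h => hp ⟨a, h⟩), abs_zero]]
      exact norm_nonneg B
  · refine norm_le_of_rows _ (norm_nonneg _) fun q => ?_
    obtain ⟨a, k⟩ := q
    rw [← row_sum_pad he B a k]
    exact row_sum_le_norm _ _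

end PadMul

section PadOne

variable [DecidableEq X'] [DecidableEq κ]

/-- the padded identity is the indicator of the image: `pad e 1 = 1_{e(X′)}` (as a multiplication operator) — `G_k(□_j,Ã_j)` inverts the cube operator ON `□_j`. [cite: Balaban1983RegularityDecay, (2.2) p.575, (2.6) p.576 (dictionary)] -/
theorem pad_one {e : X' → X} (he : Function.Injective e) (S : X → Prop) [DecidablePred S]
    (hS : ∀ z, S z ↔ ∃ a, e a = z) :
    pad e (1 : Matrix (X' × κ) (X' × κ) ℝ) = mulH (ι := κ) (fun z => if S z then (1 : ℝ) else 0) := by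
  ext p p'
  rw [mulH_apply]
  by_cases hp : ∃ a, e a = p.1
  · by_cases hp' : ∃ a', e a' = p'.1
    · obtain ⟨a, ha⟩ := hp
      obtain ⟨a', ha'⟩ := hp'
      obtain ⟨z, k⟩ := p
      obtain ⟨z', k'⟩ := p'
      simp only at ha ha'
      subst ha; subst ha'
      rw [pad_apply_img he, if_pos ((hS _).mpr ⟨a, rfl⟩)]
      by_cases hh : (a, k) = (a', k')
      · obtain ⟨rfl, rfl⟩ := Prod.mk.inj hh
        simp
      · rw [Matrix.one_apply_ne hh, if_neg]
        intro h'
        obtain ⟨h1, h2⟩ := Prod.mk.inj h'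
        exact hh (by rw [he h1, h2])
    · rw [pad_apply_of_right e 1 p (fun a h => hp' ⟨a, h⟩), if_neg]
      rintro rfl
      exact hp' hp
  · rw [pad_apply_of_left e 1 (fun a h => hp ⟨a, h⟩)]
    by_cases hpp : p = p'
    · subst hpp
      rw [if_pos rfl, if_neg (fun h => hp ((hS _).mp h))]
    · rw [if_neg hpp]

/-- a multiplication operator SUPPORTED IN THE IMAGE is the padding of the restricted one: `h = pad_e(h∘e)` for
`supp h ⊆ e(X′)` — e.g. the partition function `h_j` («h_j can be ≠ 0 only on …», p. 576).
[cite: Balaban1983RegularityDecay, (2.2) p.575, (2.6) p.576] -/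
theorem mulH_eq_pad {e : X' → X} (he : Function.Injective e) (h : X → ℝ) (hh : ∀ z, h z ≠ 0 → ∃ a, e a = z) :
    mulH (ι := κ) h = pad e (mulH (ι := κ) (fun a => h (e a))) := by
  ext p p'
  rw [mulH_apply]
  by_cases hp : ∃ a, e a = p.1
  · by_cases hp' : ∃ a', e a' = p'.1
    · obtain ⟨a, ha⟩ := hp
      obtain ⟨a', ha'⟩ := hp'
      obtain ⟨z, k⟩ := p
      obtain ⟨z', k'⟩ := p'
      simp only at ha ha'
      subst ha; subst ha'
      rw [pad_apply_img he, mulH_apply]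
      by_cases hh' : (a, k) = (a', k')
      · obtain ⟨rfl, rfl⟩ := Prod.mk.inj hh'
        simp
      · rw [if_neg hh', if_neg]
        intro h'
        obtain ⟨h1, h2⟩ := Prod.mk.inj h'
        exact hh' (by rw [he h1, h2])
    · rw [pad_apply_of_right e _ p (fun a h => hp' ⟨a, h⟩), if_neg]
      rintro rfl
      exact hp' hp
  · rw [pad_apply_of_left e _ (fun a h => hp ⟨a, h⟩)]
    by_cases hpp : p = p'
    · subst hpp
      rw [if_pos rfl]
      by_contra hne
      exact hp (hh _ hne)
    · rw [if_neg hpp]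

end PadOne

end Pad

/-! ## §3. The Neumann-cut cube operator is the sub-region operator, padded -/

/-- the NEUMANN-CUT bond weights at a site set `S` (in [B4]: `S` = the sites of the cube `□_j`; bonds with one endpoint
outside `□_j` are dropped — «the summation is over the set of all bonds … with end-points … in Ω», (1.3), for `Ω = □_j`);
reducible spelling of the walk route's `fun z z′ => if (S z ↔ S z′) then c z z′ else 0`.
[cite: Balaban1983RegularityDecay, (1.3) p.572, (2.6) p.576] -/
abbrev cutWt (S : X → Prop) [DecidablePred S] (c : X → X → ℝ) : X → X → ℝ :=
  fun z z' => if (S z ↔ S z') then c z z' else 0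

section CutWt

variable (S : X → Prop) [DecidablePred S] {e : X' → X}

/-- the cut weight between two sites of the cube is the original weight («bonds … with end-points … in Ω» kept). [cite: Balaban1983RegularityDecay, (1.3) p.572, (2.6) p.576] -/
theorem cutWt_img (hS : ∀ z, S z ↔ ∃ a, e a = z) (c : X → X → ℝ) (a b : X') :
    cutWt S c (e a) (e b) = c (e a) (e b) := by
  simp only [cutWt, if_pos (iff_of_true ((hS _).mpr ⟨a, rfl⟩) ((hS _).mpr ⟨b, rfl⟩))]

/-- the cut weight between a site of the cube and a site off the cube vanishes (both orders): the bond is dropped by the Neumann condition on `∂□_j`. [cite: Balaban1983RegularityDecay, (1.3) p.572, (2.6) p.576] -/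
theorem cutWt_img_off (hS : ∀ z, S z ↔ ∃ a, e a = z) (c : X → X → ℝ) (a : X') {z : X} (hz : ∀ b, e b ≠ z) :
    cutWt S c (e a) z = 0 ∧ cutWt S c z (e a) = 0 := by
  have h1 : S (e a) := (hS _).mpr ⟨a, rfl⟩
  have h2 : ¬ S z := fun h => by obtain ⟨b, hb⟩ := (hS z).mp h; exact hz b hb
  simp only [cutWt, if_neg (fun h : S (e a) ↔ S z => h2 (h.mp h1)),
    if_neg (fun h : S z ↔ S (e a) => h2 (h.mpr h1)), and_self]

end CutWt

section Kernel

variable [Fintype X] [Fintype Y] [Fintype κ] [DecidableEq X] [DecidableEq κ]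

/-- the BLOCK KERNEL of the operator (1.6) `H = −Δ_W + m² + aQ^*Q`:
`covLapKer + m²1[z = z′]·1 + aΣ_y q(y,z)q(y,z′)T(y,z)ᵀT(y,z′)`. [cite: Balaban1983RegularityDecay, (1.3)–(1.6) p.572] -/
def covKer (c : X → X → ℝ) (m2 a : ℝ) (q : Y → X → ℝ) (W : X → X → Matrix κ κ ℝ) (T : Y → X → Matrix κ κ ℝ)
    (z z' : X) : Matrix κ κ ℝ :=
  covLapKer c W z z' + (if z = z' then m2 • (1 : Matrix κ κ ℝ) else 0)
    + a • ∑ y, (q y z * q y z') • ((T y z)ᵀ * T y z')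

/-- (1.6) as a block operator: `covOp c m2 a q W T = blockOp (covKer …)`. [cite: Balaban1983RegularityDecay, (1.6) p.572] -/
theorem covOp_eq_blockOp' (c : X → X → ℝ) (m2 a : ℝ) (q : Y → X → ℝ) (W : X → X → Matrix κ κ ℝ)
    (T : Y → X → Matrix κ κ ℝ) : covOp c m2 a q W T = blockOp (covKer c m2 a q W T) := by
  have h1 : (m2 • (1 : Matrix (X × κ) (X × κ) ℝ))
      = blockOp fun z z' : X => if z = z' then m2 • (1 : Matrix κ κ ℝ) else 0 := by
    ext ⟨z, k⟩ ⟨z', k'⟩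
    rw [Matrix.smul_apply, blockOp_apply, Matrix.one_apply]
    by_cases hz : z = z'
    · subst hz
      simp only [if_true, Matrix.smul_apply, Matrix.one_apply, Prod.mk.injEq, true_and, smul_eq_mul, mul_ite,
        mul_one, mul_zero]
    · simp only [hz, if_false, Matrix.zero_apply, Prod.mk.injEq, false_and, smul_eq_mul, mul_zero]
  unfold covOp
  rw [covLap_eq_blockOp, projOp_eq_blockOp, h1, ← blockOp_smul, ← blockOp_add, ← blockOp_add]
  rfl

/-- entries of (1.6) through the block kernel. [cite: Balaban1983RegularityDecay, (1.6) p.572] -/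
theorem covOp_apply (c : X → X → ℝ) (m2 a : ℝ) (q : Y → X → ℝ) (W : X → X → Matrix κ κ ℝ)
    (T : Y → X → Matrix κ κ ℝ) (p p' : X × κ) :
    covOp c m2 a q W T p p' = covKer c m2 a q W T p.1 p'.1 p.2 p'.2 := by
  rw [covOp_eq_blockOp', blockOp_apply]

variable (S : X → Prop) [DecidablePred S] {e : X' → X} {eY : Y' → Y}

/-- NO ENTRY JOINS THE CUBE TO ITS COMPLEMENT: for `z ∉ S ∋ z′` the cut operator has zero `(z,z′)` and `(z′,z)` entries
— bonds across `∂S` are cut and no averaging block straddles `∂S` (`hSq`). [cite: Balaban1983RegularityDecay, (2.6) p.576] -/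
theorem covOp_cut_apply_off (c : X → X → ℝ) (m2 a : ℝ) (q : Y → X → ℝ) (W : X → X → Matrix κ κ ℝ)
    (T : Y → X → Matrix κ κ ℝ) (hSq : ∀ y z z', q y z ≠ 0 → q y z' ≠ 0 → (S z ↔ S z'))
    {z z' : X} (hz : ¬ S z) (hz' : S z') (k k' : κ) :
    covOp (cutWt S c) m2 a q W T (z, k) (z', k') = 0 ∧ covOp (cutWt S c) m2 a q W T (z', k') (z, k) = 0 := by
  have hne : z ≠ z' := by rintro rfl; exact hz hz'
  have hne' : z' ≠ z := fun h => hne h.symm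
  have hc1 : cutWt S c z z' = 0 := by simp only [cutWt, if_neg (fun h : S z ↔ S z' => hz (h.mpr hz'))]
  have hc2 : cutWt S c z' z = 0 := by simp only [cutWt, if_neg (fun h : S z' ↔ S z => hz (h.mp hz'))]
  have hP : ∑ y, (q y z * q y z') • ((T y z)ᵀ * T y z') = 0 := by
    refine Finset.sum_eq_zero fun y _ => ?_
    have : q y z * q y z' = 0 := by
      by_contra h0
      obtain ⟨h1, h2⟩ := mul_ne_zero_iff.mp h0
      exact hz ((hSq y z z' h1 h2).mpr hz')
    rw [this, zero_smul]
  have hP' : ∑ y, (q y z' * q y z) • ((T y z')ᵀ * T y z) = 0 := by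
    refine Finset.sum_eq_zero fun y _ => ?_
    have : q y z' * q y z = 0 := by
      by_contra h0
      obtain ⟨h1, h2⟩ := mul_ne_zero_iff.mp h0
      exact hz ((hSq y z' z h1 h2).mp hz')
    rw [this, zero_smul]
  have hK : covKer (cutWt S c) m2 a q W T z z' = 0 := by
    unfold covKer covLapKer
    rw [if_neg hne, if_neg hne, if_neg hne, hc1, hc2, hP]
    simp
  have hK' : covKer (cutWt S c) m2 a q W T z' z = 0 := by
    unfold covKer covLapKer
    rw [if_neg hne', if_neg hne', if_neg hne', hc1, hc2, hP']
    simp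
  constructor
  · rw [covOp_apply]
    change covKer (cutWt S c) m2 a q W T z z' k k' = 0
    rw [hK, Matrix.zero_apply]
  · rw [covOp_apply]
    change covKer (cutWt S c) m2 a q W T z' z k' k = 0
    rw [hK', Matrix.zero_apply]

omit [Fintype Y] [Fintype κ] [DecidableEq X] [DecidableEq κ] in
/-- the outgoing cut weight of a site, `Σ_{z′ on the same side of ∂S} c(z,z′)`: the diagonal of the complement block.
[cite: Balaban1983RegularityDecay, (1.3) p.572] -/
def cdeg (c : X → X → ℝ) (z : X) : ℝ := ∑ y, cutWt S c z y

/-- **THE COMPLEMENT BLOCK WITH NULL DATA IS DIAGONAL**: if the cube data carry null links between sites off `S` and null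
transporters on blocks off `S` (the free data of the walk route outside the plateau), then for `z, z′ ∉ S` the cut
operator's entry is `1[(z,k) = (z′,k′)]·(cdeg(z) + m²)`. [cite: Balaban1983RegularityDecay, (1.3)–(1.6) p.572, dictionary] -/
theorem covOp_cut_apply_compl (c : X → X → ℝ) (m2 a : ℝ) (q : Y → X → ℝ) (W : X → X → Matrix κ κ ℝ)
    (T : Y → X → Matrix κ κ ℝ) (hW0 : ∀ z z', ¬ S z → ¬ S z' → W z z' = 0)
    (hT0 : ∀ y z, ¬ S z → q y z ≠ 0 → T y z = 0) {z z' : X} (hz : ¬ S z) (hz' : ¬ S z') (k k' : κ) :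
    covOp (cutWt S c) m2 a q W T (z, k) (z', k')
      = if (z = z' ∧ k = k') then cdeg S c z + m2 else 0 := by
  have hP : ∑ y, (q y z * q y z') • ((T y z)ᵀ * T y z') = 0 := by
    refine Finset.sum_eq_zero fun y _ => ?_
    by_cases h0 : q y z = 0
    · rw [h0, zero_mul, zero_smul]
    · rw [hT0 y z hz h0, Matrix.transpose_zero, Matrix.zero_mul, smul_zero]
  have hsum0 : ∑ x, cutWt S c x z • ((W x z)ᵀ * W x z) = 0 := by
    refine Finset.sum_eq_zero fun x _ => ?_
    by_cases hx : S x
    · simp only [cutWt, if_neg (fun h : S x ↔ S z => hz (h.mp hx)), zero_smul]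
    · rw [hW0 x z hx hz, Matrix.mul_zero, smul_zero]
  rw [covOp_apply]
  change covKer (cutWt S c) m2 a q W T z z' k k' = _
  by_cases hzz : z = z'
  · subst hzz
    have hK : covKer (cutWt S c) m2 a q W T z z = (cdeg S c z + m2) • (1 : Matrix κ κ ℝ) := by
      unfold covKer covLapKer
      rw [hP, hsum0, hW0 z z hz hz, if_pos rfl, if_pos rfl, if_pos rfl, cdeg, add_smul, Finset.sum_smul]
      simp
    rw [hK, Matrix.smul_apply, Matrix.one_apply]
    by_cases hk : k = k'
    · subst hk; simp
    · simp [hk]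
  · have hne' : z' ≠ z := fun h => hzz h.symm
    have hc1 : cutWt S c z z' • W z z' = 0 := by rw [hW0 z z' hz hz', smul_zero]
    have hc2 : cutWt S c z' z • (W z' z)ᵀ = 0 := by rw [hW0 z' z hz' hz, Matrix.transpose_zero, smul_zero]
    have hK : covKer (cutWt S c) m2 a q W T z z' = 0 := by
      unfold covKer covLapKer
      rw [if_neg hzz, if_neg hzz, if_neg hzz, hc1, hc2, hP]
      simp
    rw [hK, Matrix.zero_apply, if_neg (fun h => hzz h.1)]

omit [Fintype Y] [Fintype κ] in
/-- the DIAGONAL PART OFF THE CUBE: `cdiag((z,k),(z′,k′)) = 1[(z,k) = (z′,k′), z ∉ S]·(cdeg(z) + m²)`. [folklore] -/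
def cdiag (c : X → X → ℝ) (m2 : ℝ) : Matrix (X × κ) (X × κ) ℝ :=
  Matrix.of fun p p' => if (p = p' ∧ ¬ S p.1) then cdeg S c p.1 + m2 else 0

omit [Fintype Y] [Fintype κ] in
/-- the INVERSE OF THE DIAGONAL PART off the cube: `cinv((z,k),(z′,k′)) = 1[(z,k) = (z′,k′), z ∉ S]·(cdeg(z) + m²)⁻¹`.
[folklore] -/
def cinv (c : X → X → ℝ) (m2 : ℝ) : Matrix (X × κ) (X × κ) ℝ :=
  Matrix.of fun p p' => if (p = p' ∧ ¬ S p.1) then (cdeg S c p.1 + m2)⁻¹ else 0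

section Sub

variable [Fintype X'] [Fintype Y'] [DecidableEq X']

/-- **THE `□_j`-BLOCK OF THE CUT OPERATOR IS THE SUB-REGION OPERATOR** (print (2.6)): re-indexed along the inclusion
`e : X′ ↪ X` of the cube's sites (`S = e(X′)`; block labels of the cube `e_Y : Y′ ↪ Y` carrying every averaging block
that meets the cube), the operator (1.6) on `X` with bond weights cut at `∂S` restricts to the operator (1.6) OF THE
SUB-REGION with the restricted weights, links and transporters:
`(covOp (cutWt S c) m2 a q W T)|_{S×S} = covOp (c∘e) m2 a (q∘(e_Y×e)) (W∘e) (T∘(e_Y×e))`.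
[cite: Balaban1983RegularityDecay, (2.6) p.576, (1.3)/(1.6) p.572] -/
theorem covOp_cut_submatrix (he : Function.Injective e) (hS : ∀ z, S z ↔ ∃ a, e a = z)
    (heY : Function.Injective eY) (c : X → X → ℝ) (m2 a : ℝ) (q : Y → X → ℝ) (W : X → X → Matrix κ κ ℝ)
    (T : Y → X → Matrix κ κ ℝ) (hq : ∀ y b, q y (e b) ≠ 0 → ∃ y', eY y' = y) :
    (covOp (cutWt S c) m2 a q W T).submatrix (Prod.map e id) (Prod.map e id)
      = covOp (fun b b' => c (e b) (e b')) m2 a (fun y' b => q (eY y') (e b)) (fun b b' => W (e b) (e b'))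
          (fun y' b => T (eY y') (e b)) := by
  ext ⟨b, k⟩ ⟨b', k'⟩
  simp only [Matrix.submatrix_apply, Prod.map_apply, id_eq, covOp_apply]
  -- compare the two block kernels
  have hsum1 : ∑ x, cutWt S c x (e b) • ((W x (e b))ᵀ * W x (e b))
      = ∑ a'', c (e a'') (e b) • ((W (e a'') (e b))ᵀ * W (e a'') (e b)) := by
    rw [sum_range (M := Matrix κ κ ℝ) he _ (fun x hx => by rw [(cutWt_img_off S hS c b hx).2, zero_smul])]
    refine Finset.sum_congr rfl fun a'' _ => ?_
    rw [cutWt_img S hS]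
  have hsum2 : ∑ y, cutWt S c (e b) y • (1 : Matrix κ κ ℝ) = ∑ b'', c (e b) (e b'') • (1 : Matrix κ κ ℝ) := by
    rw [sum_range (M := Matrix κ κ ℝ) he _ (fun x hx => by rw [(cutWt_img_off S hS c b hx).1, zero_smul])]
    refine Finset.sum_congr rfl fun b'' _ => ?_
    rw [cutWt_img S hS]
  have hsum3 : ∑ y, (q y (e b) * q y (e b')) • ((T y (e b))ᵀ * T y (e b'))
      = ∑ y', (q (eY y') (e b) * q (eY y') (e b')) • ((T (eY y') (e b))ᵀ * T (eY y') (e b')) := by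
    rw [sum_range (M := Matrix κ κ ℝ) heY _ (fun y hy => ?_)]
    have : q y (e b) = 0 := by
      by_contra hne
      obtain ⟨y', hy'⟩ := hq y b hne
      exact hy y' hy'
    rw [this, zero_mul, zero_smul]
  have hker : covKer (cutWt S c) m2 a q W T (e b) (e b')
      = covKer (fun b b' => c (e b) (e b')) m2 a (fun y' b => q (eY y') (e b)) (fun b b' => W (e b) (e b'))
          (fun y' b => T (eY y') (e b)) b b' := by
    unfold covKer covLapKer
    rw [hsum1, hsum2, hsum3, cutWt_img S hS, cutWt_img S hS]
    by_cases hb : b = b'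
    · subst hb
      simp only [if_true]
    · have hne : e b ≠ e b' := fun h => hb (he h)
      simp only [if_neg hne, if_neg hb]
  rw [hker]

/-- **`H_cut = pad_e(H_□) + cdiag`**: the Neumann-cut cube operator on `X` (null links/transporters off the cube) is the
zero-padded operator (1.6) OF THE SUB-REGION plus a diagonal operator supported off the cube.
[cite: Balaban1983RegularityDecay, (2.6) p.576, (2.2) p.575] -/
theorem covOp_cut_eq_pad_add (he : Function.Injective e) (hS : ∀ z, S z ↔ ∃ a, e a = z)
    (heY : Function.Injective eY) (c : X → X → ℝ) (m2 a : ℝ) (q : Y → X → ℝ) (W : X → X → Matrix κ κ ℝ)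
    (T : Y → X → Matrix κ κ ℝ) (hq : ∀ y b, q y (e b) ≠ 0 → ∃ y', eY y' = y)
    (hSq : ∀ y z z', q y z ≠ 0 → q y z' ≠ 0 → (S z ↔ S z'))
    (hW0 : ∀ z z', ¬ S z → ¬ S z' → W z z' = 0) (hT0 : ∀ y z, ¬ S z → q y z ≠ 0 → T y z = 0) :
    covOp (cutWt S c) m2 a q W T
      = pad e (covOp (fun b b' => c (e b) (e b')) m2 a (fun y' b => q (eY y') (e b)) (fun b b' => W (e b) (e b'))
          (fun y' b => T (eY y') (e b))) + cdiag S c m2 := by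
  ext p p'
  rw [Matrix.add_apply]
  by_cases hp : ∃ b, e b = p.1
  · have hSp : S p.1 := (hS _).mpr hp
    have hdiag : cdiag S c m2 p p' = (0 : ℝ) := by
      simp only [cdiag, Matrix.of_apply, if_neg (fun h : p = p' ∧ ¬ S p.1 => h.2 hSp)]
    by_cases hp' : ∃ b', e b' = p'.1
    · obtain ⟨b, hb⟩ := hp
      obtain ⟨b', hb'⟩ := hp'
      obtain ⟨z, k⟩ := p
      obtain ⟨z', k'⟩ := p'
      simp only at hb hb'
      subst hb; subst hb'
      rw [hdiag, add_zero, pad_apply_img he, ← covOp_cut_submatrix S he hS heY c m2 a q W T hq]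
      simp
    · have hSp' : ¬ S p'.1 := fun h => hp' ((hS _).mp h)
      rw [hdiag, add_zero, pad_apply_of_right e _ p (fun b h => hp' ⟨b, h⟩)]
      obtain ⟨z, k⟩ := p
      obtain ⟨z', k'⟩ := p'
      exact (covOp_cut_apply_off S c m2 a q W T hSq hSp' hSp k' k).2
  · have hSp : ¬ S p.1 := fun h => hp ((hS _).mp h)
    rw [pad_apply_of_left e _ (fun b h => hp ⟨b, h⟩), zero_add]
    obtain ⟨z, k⟩ := p
    obtain ⟨z', k'⟩ := p'
    by_cases hSp' : S z'
    · have : cdiag S c m2 (z, k) (z', k') = (0 : ℝ) := by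
        simp only [cdiag, Matrix.of_apply]
        rw [if_neg]
        rintro ⟨h, -⟩
        obtain ⟨rfl, -⟩ := Prod.mk.inj h
        exact hSp hSp'
      rw [this]
      exact (covOp_cut_apply_off S c m2 a q W T hSq hSp hSp' k k').1
    · rw [covOp_cut_apply_compl S c m2 a q W T hW0 hT0 hSp hSp' k k']
      simp only [cdiag, Matrix.of_apply, Prod.mk.injEq]
      by_cases h : z = z' ∧ k = k'
      · rw [if_pos h, if_pos ⟨h, hSp⟩]
      · rw [if_neg h, if_neg (fun h' => h h'.1)]

end Sub

/-! ## §4. The two-sided inverse of the cut operator and its norm -/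

omit [Fintype Y] in
/-- the diagonal part times its inverse is the indicator of the complement. [folklore] -/
private theorem cdiag_mul_cinv (c : X → X → ℝ) (m2 : ℝ) (hdeg : ∀ z, ¬ S z → cdeg S c z + m2 ≠ 0) :
    cdiag S c m2 * cinv S c m2 = mulH (ι := κ) (fun z => if S z then (0 : ℝ) else 1) := by
  ext p p'
  rw [Matrix.mul_apply, mulH_apply]
  by_cases hSp : S p.1
  · rw [Finset.sum_eq_zero fun r _ => by
        have h0 : cdiag S c m2 p r = (0 : ℝ) := if_neg (fun h => h.2 hSp)
        rw [h0, zero_mul]]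
    by_cases hpp : p = p'
    · rw [if_pos hpp, if_pos hSp]
    · rw [if_neg hpp]
  · rw [Finset.sum_eq_single p]
    · by_cases hpp : p = p'
      · subst hpp
        have h1 : cdiag S c m2 p p = cdeg S c p.1 + m2 := if_pos ⟨rfl, hSp⟩
        have h2 : cinv S c m2 p p = (cdeg S c p.1 + m2)⁻¹ := if_pos ⟨rfl, hSp⟩
        rw [h1, h2, mul_inv_cancel₀ (hdeg _ hSp), if_pos rfl, if_neg hSp]
      · have h2 : cinv S c m2 p p' = (0 : ℝ) := if_neg (fun h => hpp h.1)
        rw [h2, mul_zero, if_neg hpp]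
    · intro r _ hr
      have h0 : cdiag S c m2 p r = (0 : ℝ) := if_neg (fun h => hr h.1.symm)
      rw [h0, zero_mul]
    · intro h; exact absurd (Finset.mem_univ p) h

section Inv

variable [Fintype X']

omit [Fintype Y] in
/-- a padded operator kills the complement's diagonal inverse: `pad(B)·cinv = 0`. [folklore] -/
private theorem pad_mul_cinv (hS : ∀ z, S z ↔ ∃ a, e a = z) (B : Matrix (X' × κ) (X' × κ) ℝ) (c : X → X → ℝ) (m2 : ℝ) :
    pad e B * cinv S c m2 = 0 := by
  ext p p'
  rw [Matrix.mul_apply, Matrix.zero_apply]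
  refine Finset.sum_eq_zero fun r _ => ?_
  by_cases hr : S r.1
  · simp only [cinv, Matrix.of_apply, if_neg (fun h : r = p' ∧ ¬ S r.1 => h.2 hr), mul_zero]
  · rw [pad_apply_of_right e B p (fun a h => hr ((hS _).mpr ⟨a, h⟩)), zero_mul]

omit [Fintype Y] in
/-- a padded operator kills the complement's diagonal part: `pad(B)·cdiag = 0`. [folklore] -/
private theorem pad_mul_cdiag (hS : ∀ z, S z ↔ ∃ a, e a = z) (B : Matrix (X' × κ) (X' × κ) ℝ) (c : X → X → ℝ) (m2 : ℝ) :
    pad e B * cdiag S c m2 = 0 := by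
  ext p p'
  rw [Matrix.mul_apply, Matrix.zero_apply]
  refine Finset.sum_eq_zero fun r _ => ?_
  by_cases hr : S r.1
  · simp only [cdiag, Matrix.of_apply, if_neg (fun h : r = p' ∧ ¬ S r.1 => h.2 hr), mul_zero]
  · rw [pad_apply_of_right e B p (fun a h => hr ((hS _).mpr ⟨a, h⟩)), zero_mul]

omit [Fintype Y] in
/-- symmetric form: `cinv·pad(B) = 0`. [folklore] -/
private theorem cinv_mul_pad (hS : ∀ z, S z ↔ ∃ a, e a = z) (B : Matrix (X' × κ) (X' × κ) ℝ) (c : X → X → ℝ) (m2 : ℝ) :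
    cinv S c m2 * pad e B = 0 := by
  ext p p'
  rw [Matrix.mul_apply, Matrix.zero_apply]
  refine Finset.sum_eq_zero fun r _ => ?_
  by_cases hr : S r.1
  · have : cinv S c m2 p r = 0 := by
      simp only [cinv, Matrix.of_apply]
      rw [if_neg]
      rintro ⟨rfl, h⟩
      exact h hr
    rw [this, zero_mul]
  · rw [pad_apply_of_left e B (fun a h => hr ((hS _).mpr ⟨a, h⟩)), mul_zero]

omit [Fintype Y] in
/-- the diagonal part kills a padded operator: `cdiag·pad(B) = 0`. [folklore] -/
private theorem cdiag_mul_pad (hS : ∀ z, S z ↔ ∃ a, e a = z) (B : Matrix (X' × κ) (X' × κ) ℝ) (c : X → X → ℝ) (m2 : ℝ) :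
    cdiag S c m2 * pad e B = 0 := by
  ext p p'
  rw [Matrix.mul_apply, Matrix.zero_apply]
  refine Finset.sum_eq_zero fun r _ => ?_
  by_cases hr : S r.1
  · have : cdiag S c m2 p r = 0 := by
      simp only [cdiag, Matrix.of_apply]
      rw [if_neg]
      rintro ⟨rfl, h⟩
      exact h hr
    rw [this, zero_mul]
  · rw [pad_apply_of_left e B (fun a h => hr ((hS _).mpr ⟨a, h⟩)), mul_zero]

/-- **THE INPUT `γ`**: `‖pad_e(G_□) + cinv‖_{ℓ∞→ℓ∞} ≤ max ‖G_□‖ m₀⁻¹` whenever `0 < m₀ ≤ cdeg + m²` off the cube — the sup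
operator norm of the walk route's cube propagator is that of `G_k(□_j,Ã_j)` (Lemma 2.2 (2.17) at `p = q = ∞`), up to the
harmless diagonal off the cube. [cite: Balaban1983RegularityDecay, (2.17) p.578, (2.20) p.578] -/
theorem norm_padInv_le (he : Function.Injective e) (hS : ∀ z, S z ↔ ∃ a, e a = z) (c : X → X → ℝ) (m2 : ℝ)
    {m₀ : ℝ} (hm₀ : 0 < m₀) (hdeg : ∀ z, ¬ S z → m₀ ≤ cdeg S c z + m2) (G : Matrix (X' × κ) (X' × κ) ℝ) :
    ‖pad e G + cinv S c m2‖ ≤ max ‖G‖ m₀⁻¹ := by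
  refine norm_le_of_rows _ ((norm_nonneg G).trans (le_max_left _ _)) fun p => ?_
  simp only [Matrix.add_apply]
  by_cases hp : ∃ a, e a = p.1
  · have hSp : S p.1 := (hS _).mpr hp
    obtain ⟨a, ha⟩ := hp
    obtain ⟨z, k⟩ := p
    simp only at ha hSp
    subst ha
    have hrow : ∀ p', pad e G (e a, k) p' + cinv S c m2 (e a, k) p' = pad e G (e a, k) p' := by
      intro p'
      have h0 : cinv S c m2 (e a, k) p' = (0 : ℝ) := if_neg (fun h => h.2 hSp)
      rw [h0, add_zero]
    simp only [hrow]
    rw [row_sum_pad he]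
    exact (row_sum_le_norm G (a, k)).trans (le_max_left _ _)
  · have hSp : ¬ S p.1 := fun h => hp ((hS _).mp h)
    have hrow : ∀ p', pad e G p p' + cinv S c m2 p p' = if p = p' then (cdeg S c p.1 + m2)⁻¹ else 0 := by
      intro p'
      rw [pad_apply_of_left e G (fun a h => hp ⟨a, h⟩), zero_add]
      by_cases hpp : p = p'
      · rw [if_pos hpp]
        exact if_pos ⟨hpp, hSp⟩
      · rw [if_neg hpp]
        exact if_neg (fun h => hpp h.1)
    simp only [hrow]
    rw [Finset.sum_eq_single p]
    · rw [if_pos rfl]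
      have hpos : 0 < cdeg S c p.1 + m2 := hm₀.trans_le (hdeg _ hSp)
      rw [abs_of_pos (inv_pos.mpr hpos)]
      exact (inv_anti₀ hm₀ (hdeg _ hSp)).trans (le_max_right _ _)
    · intro p' _ hp'; rw [if_neg (Ne.symm hp'), abs_zero]
    · intro h; exact absurd (Finset.mem_univ p) h

variable [Fintype Y'] [DecidableEq X']

/-- **THE HYPOTHESIS `hGj` OF THE WALK ROUTE, DISCHARGED FROM THE SUB-REGION'S GREEN'S FUNCTION**: if `G_□` is a right
inverse of the sub-region operator (1.6) (`H_□·G_□ = 1`, i.e. `G_□ = G_k(□_j,Ã_j)`) and `cdeg + m² ≠ 0` off the cube, then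
`G_j := pad_e(G_□) + cinv` is a right (hence two-sided) inverse of the Neumann-cut cube operator on `X`:
`covOp (cutWt S c) m2 a q W T · G_j = 1`. [cite: Balaban1983RegularityDecay, (2.2) p.575, (2.6) p.576] -/
theorem covOp_cut_mul_padInv (he : Function.Injective e) (hS : ∀ z, S z ↔ ∃ a, e a = z)
    (heY : Function.Injective eY) (c : X → X → ℝ) (m2 a : ℝ) (q : Y → X → ℝ) (W : X → X → Matrix κ κ ℝ)
    (T : Y → X → Matrix κ κ ℝ) (hq : ∀ y b, q y (e b) ≠ 0 → ∃ y', eY y' = y)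
    (hSq : ∀ y z z', q y z ≠ 0 → q y z' ≠ 0 → (S z ↔ S z'))
    (hW0 : ∀ z z', ¬ S z → ¬ S z' → W z z' = 0) (hT0 : ∀ y z, ¬ S z → q y z ≠ 0 → T y z = 0)
    (hdeg : ∀ z, ¬ S z → cdeg S c z + m2 ≠ 0) {G : Matrix (X' × κ) (X' × κ) ℝ}
    (hG : covOp (fun b b' => c (e b) (e b')) m2 a (fun y' b => q (eY y') (e b)) (fun b b' => W (e b) (e b'))
      (fun y' b => T (eY y') (e b)) * G = 1) :
    covOp (cutWt S c) m2 a q W T * (pad e G + cinv S c m2) = 1 := by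
  rw [covOp_cut_eq_pad_add S he hS heY c m2 a q W T hq hSq hW0 hT0, Matrix.add_mul, Matrix.mul_add,
    Matrix.mul_add, pad_mul he, hG, pad_one he S hS, pad_mul_cinv S hS, cdiag_mul_pad S hS,
    cdiag_mul_cinv S c m2 hdeg, add_zero, zero_add, ← mulH_add]
  convert mulH_one (X := X) (ι := κ) using 2
  funext z
  simp only [Pi.add_apply]
  split_ifs <;> norm_num

/-! ## §5. The letters `h_jG_jh_j` (2.2) and `K_jG_jh_j` (2.11) are the padded sub-region letters -/

omit [Fintype Y] [Fintype Y'] in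
/-- **`h·G_j·h = pad_e(h_□·G_□·h_□)`** for `supp h ⊆ □_j` (`h_□ = h∘e`): the letter `h_jG_k(□_j,Ã_j)h_j` of (2.2)/(2.13).
[cite: Balaban1983RegularityDecay, (2.2) p.575, (2.13) p.577] -/
theorem letter_a_eq_pad (he : Function.Injective e) (hS : ∀ z, S z ↔ ∃ a, e a = z) (c : X → X → ℝ) (m2 : ℝ)
    (h : X → ℝ) (hh : ∀ z, h z ≠ 0 → S z) (G : Matrix (X' × κ) (X' × κ) ℝ) :
    mulH (ι := κ) h * (pad e G + cinv S c m2) * mulH (ι := κ) h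
      = pad e (mulH (ι := κ) (fun a => h (e a)) * G * mulH (ι := κ) (fun a => h (e a))) := by
  have hh' : ∀ z, h z ≠ 0 → ∃ a, e a = z := fun z hz => (hS z).mp (hh z hz)
  rw [mulH_eq_pad he h hh', Matrix.mul_add, pad_mul_cinv S hS, add_zero, pad_mul he, pad_mul he]

omit [Fintype Y] [Fintype Y'] in
/-- the norm of the letter `h·G_j·h` is that of the sub-region letter. [cite: Balaban1983RegularityDecay, (2.20) p.578] -/
theorem norm_letter_a (he : Function.Injective e) (hS : ∀ z, S z ↔ ∃ a, e a = z) (c : X → X → ℝ) (m2 : ℝ)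
    (h : X → ℝ) (hh : ∀ z, h z ≠ 0 → S z) (G : Matrix (X' × κ) (X' × κ) ℝ) :
    ‖mulH (ι := κ) h * (pad e G + cinv S c m2) * mulH (ι := κ) h‖
      = ‖mulH (ι := κ) (fun a => h (e a)) * G * mulH (ι := κ) (fun a => h (e a))‖ := by
  rw [letter_a_eq_pad S he hS c m2 h hh G, norm_pad he]

/-- **`K_h = pad_e(K_{h_□})`**: the commutator (2.10) `K_h = h·H_cut − H_cut·h` of the cut operator (null data off the cube)
with a function supported in the cube is the padded commutator of the SUB-REGION operator with `h∘e` (the diagonal part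
off the cube commutes past and drops out). [cite: Balaban1983RegularityDecay, (2.10) p.576] -/
theorem opK_cut_eq_pad (he : Function.Injective e) (hS : ∀ z, S z ↔ ∃ a, e a = z)
    (heY : Function.Injective eY) (c : X → X → ℝ) (m2 a : ℝ) (q : Y → X → ℝ) (W : X → X → Matrix κ κ ℝ)
    (T : Y → X → Matrix κ κ ℝ) (hq : ∀ y b, q y (e b) ≠ 0 → ∃ y', eY y' = y)
    (hSq : ∀ y z z', q y z ≠ 0 → q y z' ≠ 0 → (S z ↔ S z'))
    (hW0 : ∀ z z', ¬ S z → ¬ S z' → W z z' = 0) (hT0 : ∀ y z, ¬ S z → q y z ≠ 0 → T y z = 0)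
    (h : X → ℝ) (hh : ∀ z, h z ≠ 0 → S z) :
    opK (cutWt S c) m2 a q W T h
      = pad e (opK (fun b b' => c (e b) (e b')) m2 a (fun y' b => q (eY y') (e b)) (fun b b' => W (e b) (e b'))
          (fun y' b => T (eY y') (e b)) (fun a => h (e a))) := by
  have hh' : ∀ z, h z ≠ 0 → ∃ a, e a = z := fun z hz => (hS z).mp (hh z hz)
  unfold opK
  rw [covOp_cut_eq_pad_add S he hS heY c m2 a q W T hq hSq hW0 hT0, mulH_eq_pad he h hh', Matrix.mul_add,
    Matrix.add_mul, pad_mul he, pad_mul he, pad_mul_cdiag S hS, cdiag_mul_pad S hS, add_zero, add_zero, ← pad_sub]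

/-- **`K_h·G_j·h = pad_e(K_{h_□}·G_□·h_□)`**: the letter `K_jG_k(□_j,Ã_j)h_j` of (2.11)/(2.13) built from the cut operator
on `X` and `G_j = pad_e(G_□) + cinv` is the padded letter of the sub-region.
[cite: Balaban1983RegularityDecay, (2.11) p.576, (2.13) p.577] -/
theorem letter_b_eq_pad (he : Function.Injective e) (hS : ∀ z, S z ↔ ∃ a, e a = z)
    (heY : Function.Injective eY) (c : X → X → ℝ) (m2 a : ℝ) (q : Y → X → ℝ) (W : X → X → Matrix κ κ ℝ)
    (T : Y → X → Matrix κ κ ℝ) (hq : ∀ y b, q y (e b) ≠ 0 → ∃ y', eY y' = y)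
    (hSq : ∀ y z z', q y z ≠ 0 → q y z' ≠ 0 → (S z ↔ S z'))
    (hW0 : ∀ z z', ¬ S z → ¬ S z' → W z z' = 0) (hT0 : ∀ y z, ¬ S z → q y z ≠ 0 → T y z = 0)
    (h : X → ℝ) (hh : ∀ z, h z ≠ 0 → S z) (G : Matrix (X' × κ) (X' × κ) ℝ) :
    opK (cutWt S c) m2 a q W T h * (pad e G + cinv S c m2) * mulH (ι := κ) h
      = pad e (opK (fun b b' => c (e b) (e b')) m2 a (fun y' b => q (eY y') (e b)) (fun b b' => W (e b) (e b'))
          (fun y' b => T (eY y') (e b)) (fun a => h (e a)) * G * mulH (ι := κ) (fun a => h (e a))) := by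
  have hh' : ∀ z, h z ≠ 0 → ∃ a, e a = z := fun z hz => (hS z).mp (hh z hz)
  rw [opK_cut_eq_pad S he hS heY c m2 a q W T hq hSq hW0 hT0 h hh, Matrix.mul_add, pad_mul_cinv S hS, add_zero,
    pad_mul he, mulH_eq_pad he h hh', pad_mul he]

/-- **THE INPUT `β` IS THE SUB-REGION'S FACTOR BOUND (2.20)**: `‖K_h·G_j·h‖ = ‖K_{h_□}·G_□·h_□‖`.
[cite: Balaban1983RegularityDecay, (2.20) p.578] -/
theorem norm_letter_b (he : Function.Injective e) (hS : ∀ z, S z ↔ ∃ a, e a = z)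
    (heY : Function.Injective eY) (c : X → X → ℝ) (m2 a : ℝ) (q : Y → X → ℝ) (W : X → X → Matrix κ κ ℝ)
    (T : Y → X → Matrix κ κ ℝ) (hq : ∀ y b, q y (e b) ≠ 0 → ∃ y', eY y' = y)
    (hSq : ∀ y z z', q y z ≠ 0 → q y z' ≠ 0 → (S z ↔ S z'))
    (hW0 : ∀ z z', ¬ S z → ¬ S z' → W z z' = 0) (hT0 : ∀ y z, ¬ S z → q y z ≠ 0 → T y z = 0)
    (h : X → ℝ) (hh : ∀ z, h z ≠ 0 → S z) (G : Matrix (X' × κ) (X' × κ) ℝ) :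
    ‖opK (cutWt S c) m2 a q W T h * (pad e G + cinv S c m2) * mulH (ι := κ) h‖
      = ‖opK (fun b b' => c (e b) (e b')) m2 a (fun y' b => q (eY y') (e b)) (fun b b' => W (e b) (e b'))
          (fun y' b => T (eY y') (e b)) (fun a => h (e a)) * G * mulH (ι := κ) (fun a => h (e a))‖ := by
  rw [letter_b_eq_pad S he hS heY c m2 a q W T hq hSq hW0 hT0 h hh G, norm_pad he]

end Inv

end Kernel

/-! ## §6. Norm dictionary: the lineage's sup norm `supN` bounds the `ℓ^∞`-operator norm -/

section Dictionary

variable [Fintype κ]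

/-- a component is at most the Euclidean colour norm: `|v_k| ≤ |v|`. [folklore] -/
private theorem abs_apply_le_siteNorm (v : κ → ℝ) (k : κ) : |v k| ≤ siteNorm v := by
  unfold siteNorm
  apply Real.abs_le_sqrt
  rw [dotProduct]
  calc v k ^ 2 = v k * v k := sq (v k)
    _ ≤ ∑ i, v i * v i := Finset.single_le_sum (f := fun i => v i * v i) (fun i _ => mul_self_nonneg (v i))
        (Finset.mem_univ k)

/-- a colour vector with entries in `[−1, 1]` has Euclidean norm `≤ √N`. [folklore] -/
private theorem siteNorm_le_sqrt_card (v : κ → ℝ) (hv : ∀ k, |v k| ≤ 1) : siteNorm v ≤ Real.sqrt (Fintype.card κ) := by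
  unfold siteNorm
  apply Real.sqrt_le_sqrt
  rw [dotProduct]
  calc ∑ i, v i * v i ≤ ∑ _i : κ, (1 : ℝ) := Finset.sum_le_sum fun i _ => by
          have h := hv i
          rw [abs_le] at h
          nlinarith [h.1, h.2]
    _ = Fintype.card κ := by simp

variable [Fintype X]

/-- **NORM DICTIONARY**: an operator `T` on `ℝ^N`-valued lattice functions with the lineage's sup-norm bound
`supN(TΦ) ≤ C·supN(Φ)` (sup over sites of the Euclidean colour norm — the form in which the Lemma-2.2 lineage states
(2.17) at `p = q = ∞` and the factor bound (2.20)) has `ℓ^∞`-operator norm `‖T‖ ≤ √N·C` (`N = card κ`) — the form in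
which the walk route (`B4Ineq110WalkRoute`) consumes `γ` and `β`. [cite: Balaban1983RegularityDecay, (2.17)/(2.20) p.578
«Here ‖T‖_{q,p} denotes a norm of an operator T : L^p → L^q»] -/
theorem linfty_opNorm_le_of_supN (T : Matrix (X × κ) (X × κ) ℝ) {C : ℝ} (hC : 0 ≤ C)
    (hT : ∀ Φ : X × κ → ℝ, supN (T *ᵥ Φ) ≤ C * supN Φ) :
    ‖T‖ ≤ Real.sqrt (Fintype.card κ) * C := by
  refine norm_le_of_rows _ (by positivity) fun p => ?_
  -- test against the sign pattern of the row
  set Φ : X × κ → ℝ := fun p' => if 0 ≤ T p p' then 1 else -1 with hΦ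
  have hΦ1 : ∀ p', |Φ p'| ≤ 1 := fun p' => by
    simp only [hΦ]; split_ifs <;> simp
  have hsupΦ : supN Φ ≤ Real.sqrt (Fintype.card κ) :=
    supN_le (Real.sqrt_nonneg _) fun x => siteNorm_le_sqrt_card _ fun k => hΦ1 (x, k)
  have hrow : ∑ p', |T p p'| = (T *ᵥ Φ) p := by
    rw [Matrix.mulVec, dotProduct]
    refine Finset.sum_congr rfl fun p' _ => ?_
    simp only [hΦ]
    split_ifs with h
    · rw [mul_one, abs_of_nonneg h]
    · rw [mul_neg, mul_one, abs_of_neg (not_le.mp h)]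
  calc ∑ p', |T p p'| = (T *ᵥ Φ) p := hrow
    _ ≤ |(T *ᵥ Φ) p| := le_abs_self _
    _ = |fld (T *ᵥ Φ) p.1 p.2| := rfl
    _ ≤ siteNorm (fld (T *ᵥ Φ) p.1) := abs_apply_le_siteNorm _ _
    _ ≤ supN (T *ᵥ Φ) := le_supN _ _
    _ ≤ C * supN Φ := hT Φ
    _ ≤ C * Real.sqrt (Fintype.card κ) := mul_le_mul_of_nonneg_left hsupΦ hC
    _ = Real.sqrt (Fintype.card κ) * C := mul_comm _ _

end Dictionary

end

end Literature.MathematicalPhysics.QuantumFieldTheory.Balaban1983to89.B4CubeOpReindex
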